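import Literature.Analysis.Matrix.SymmetrizedCollatzBound
import HarnessLib

/-!
# The front-local residual identity of a multifrontal factorisation — why per-front bounds bound the GLOBAL residual

Topic `Analysis/Matrix`; namespace `Literature.Analysis.Matrix.MultifrontalResidual`.
HONEST FRAMING (cell certnum, D-0105 (6); layer L1/L4; seat certnum-ila-1, author of `cap.ila.mfldl`, LIVE as
cap-ila 0.3.0 «mf»): a typed and PROVED bookkeeping identity (pure algebra over any commutative ring) plus its
two analytic corollaries over `ℝ`; it certifies no engine output. 0 definitions, 0 named facts, 0 `sorry`.

THE METHOD [cite: DuffReid1983, §2–§3] [cite: Liu1992Multifrontal, §4] [cite: Duff1994AugmentedSystems, §4 p. 44]: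
a multifrontal `LDLᵀ` factorisation processes FRONTS `s` in a postorder of the assembly tree. Front `s`
ASSEMBLES `F_s = (original entries owned by s) ⊕ Σ_{children c} U_c` (the children's passed-up update /
contribution blocks), eliminates its pivots, which yields the block column `G_s` of the global factor and the
local product `P_s = G_s S_s G_sᵀ`, and passes `U_s := F_s − P_s` (restricted to the non-pivot rows) up to its
parent; roots pass nothing. In exact arithmetic the telescoping of the `U_c` gives `H(p,p) = G·S·Gᵀ`.

WHAT THE KERNEL DOES (`cap.ila.mfldl.factor_aug` / `factor_aug_dd`, docstring «THE IDENTITY»): in floating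
point the assembly is inexact. Writing, in GLOBAL (scattered) coordinates, `E_s := F̂_s − P_s − U_s` (the local
residual of front `s`, with the float front `F̂_s` actually formed) and `A_s := F̂_s − (H_s^orig + Σ_c U_c)` (its
assembly error), every `U_c` (c not a root) occurs once with `+` (in its parent's `A`) and once with `−` (in its
own `E`), so EXACTLY
        `H(p,p) − G·diag(d)·Gᵀ = Σ_s (E_s − A_s)`                    (`residual_eq_sum_frontal`)
whatever the factor, the pivoting, the ordering or the accuracy. Hence per-front ENTRYWISE bounds
`B_s ≥ |E_s − A_s|` (the kernel's TwoSum-chain majorants) give `|H(p,p) − G·diag(d)·Gᵀ| ≤ W := Σ_s B_s`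
entrywise (`abs_residual_le_sum_frontal_bound`) — `W` is never materialised, only `W·x` and `Wᵀ·x` — and the
tree's (1.8) with the symmetrised majorant (`SparseLUSplit.norm_toLp_mulVec_le_of_symm_collatz`, p545825) turns
the kernel's `ρ := max_i ((W + Wᵀ)x)_i / (2x_i)` into `‖(H(p,p) − G·diag(d)·Gᵀ) v‖₂ ≤ ρ‖v‖₂`
(`norm_residual_mulVec_le_of_frontal_bounds`) — which is hypothesis `hΔ` of the certificate theorem
`AugmentedInertiaCertificate.sigma_lower_of_augmented_certificate` (p516764) with `Δ := H(p,p) − G·diag(d)·Gᵀ`.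
The two other inputs of the identity are typed as well: the original entries are assigned to exactly one front
each (`sum_ownedEntries`), and `G·diag(d)·Gᵀ` is the sum over fronts of the block-column products
(`mul_diagonal_mul_transpose_eq_sum_blockCol`: the block column of front `s` is `G·diag(χ_s)`, `χ_s` the indicator of
its pivots; in the kernel `S_s` is the ±1 diagonal `d` restricted to the pivots of `s` — the 2×2 pivot rotations
are absorbed into `G = L·D̂`).
WHAT IS NOT CERTIFIED: how `F̂_s`, `P_s`, `U_s` and the bounds `B_s` are obtained in floating point (exact slice
products under H-BLAS-EXACT, TwoSum chains, upward rounding — hypotheses and arithmetic of the certificate, see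
`cap/ila/mfldl.py`), and nothing about the accuracy of the factor (the identity holds for ANY `G`, `d`, `U`).
-/

open Finset Matrix WithLp

namespace Literature.Analysis.Matrix.MultifrontalResidual

variable {ι : Type*} [Fintype ι] [DecidableEq ι]
variable {S : Type*} [Fintype S] [DecidableEq S]
variable {R : Type*} [CommRing R]

/-! ### §1 The three bookkeeping facts -/

/-- **Children are counted once.** For a parent map `parent : S → Option S` (`none` = root) and any
front-indexed family `U`, summing over every front the family over ITS CHILDREN equals summing the family over
all NON-ROOT fronts: `Σ_s Σ_{c : parent c = s} U_c = Σ_{c : parent c ≠ none} U_c`.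
[cite: Liu1992Multifrontal, §4 (assembly tree)] -/
theorem sum_children_eq_sum_nonroot {M : Type*} [AddCommMonoid M] (parent : S → Option S) (U : S → M) :
    ∑ s, ∑ c ∈ univ.filter (fun c => parent c = some s), U c =
      ∑ c ∈ univ.filter (fun c => parent c ≠ none), U c := by
  simp only [sum_filter]
  rw [sum_comm]
  refine sum_congr rfl fun c _ => ?_
  cases hpc : parent c with
  | none => simp
  | some t => simp [Option.some.injEq, eq_comm]

omit [Fintype ι] [DecidableEq ι] in
/-- **Original entries are assembled exactly once.** If every position `(i, j)` is OWNED by one front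
`own i j`, the owned parts sum to the matrix. [cite: DuffReid1983, §2] -/
theorem sum_ownedEntries (own : ι → ι → S) (H : Matrix ι ι R) :
    ∑ s, Matrix.of (fun i j => if own i j = s then H i j else 0) = H := by
  ext i j
  rw [Matrix.sum_apply]
  simp only [of_apply, sum_ite_eq, mem_univ, ↓reduceIte]

/-- **`G·diag(d)·Gᵀ` is the sum over fronts of the block-column products.** With the column partition
`blk : ι → S` (pivot `k` belongs to front `blk k`) and `χ_s` the indicator of the pivots of `s`, the block
column of front `s` is `G·diag(χ_s)` (the other columns zeroed — the scattered dense `G_s` of the kernel) and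
`G·diag(d)·Gᵀ = Σ_s (G·diag(χ_s))·diag(d)·(G·diag(χ_s))ᵀ` (`(G d Gᵀ)_{ij} = Σ_k G_{ik} d_k G_{jk}` grouped by
the front owning `k`). [cite: Liu1992Multifrontal, §4] -/
theorem mul_diagonal_mul_transpose_eq_sum_blockCol (G : Matrix ι ι R) (d : ι → R) (blk : ι → S) :
    G * diagonal d * Gᵀ = ∑ s, G * diagonal (fun k => if blk k = s then (1 : R) else 0) * diagonal d *
      (G * diagonal (fun k => if blk k = s then (1 : R) else 0))ᵀ := by
  ext i j
  have hL : (G * diagonal d * Gᵀ) i j = ∑ k, G i k * d k * G j k := by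
    rw [mul_apply]; simp only [mul_diagonal, transpose_apply]
  have hR : ∀ s, (G * diagonal (fun k => if blk k = s then (1 : R) else 0) * diagonal d *
      (G * diagonal (fun k => if blk k = s then (1 : R) else 0))ᵀ) i j =
      ∑ k, if blk k = s then G i k * d k * G j k else 0 := fun s => by
    rw [mul_apply]; simp only [mul_diagonal, transpose_apply]
    refine sum_congr rfl fun k _ => ?_
    by_cases h : blk k = s
    · simp [h]
    · simp [h]
  rw [hL, Matrix.sum_apply]
  simp only [hR]
  rw [sum_comm]
  exact sum_congr rfl fun k _ => by simp [sum_ite_eq]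

/-! ### §2 The identity -/

omit [DecidableEq ι] in
/-- **THE FRONT-LOCAL RESIDUAL IDENTITY of a multifrontal factorisation.** Fronts `s : S` with parent map
`parent` (`none` = root); in GLOBAL coordinates let `F s` be the front actually assembled, `P s` its local
product, `U s` the block it passes up (`U s = 0` for roots), `Horig s` the original entries it owns, with
`Σ_s Horig s = Hpp` and `Σ_s P s = GdG`. Then, with the local residual `E_s := F_s − P_s − U_s` and the assembly
error `A_s := F_s − (Horig_s + Σ_{c child of s} U_c)`,
`Hpp − GdG = Σ_s (E_s − A_s)` EXACTLY — for any `F`, `P`, `U` whatsoever.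
[cite: DuffReid1983, §3] [cite: Liu1992Multifrontal, §4] -/
theorem residual_eq_sum_frontal {M : Type*} [AddCommGroup M] (parent : S → Option S) (Hpp GdG : M)
    (F P U Horig : S → M) (hH : ∑ s, Horig s = Hpp) (hP : ∑ s, P s = GdG)
    (hroot : ∀ s, parent s = none → U s = 0) :
    Hpp - GdG = ∑ s, ((F s - P s - U s) -
      (F s - (Horig s + ∑ c ∈ univ.filter (fun c => parent c = some s), U c))) := by
  have hsplit : ∑ s, U s = ∑ c ∈ univ.filter (fun c => parent c ≠ none), U c := by
    rw [← sum_filter_add_sum_filter_not univ (fun c => parent c ≠ none) U]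
    have h0 : ∑ c ∈ univ.filter (fun c => ¬ parent c ≠ none), U c = 0 :=
      sum_eq_zero fun c hc => hroot c (by simpa using (mem_filter.1 hc).2)
    rw [h0, add_zero]
  have hsum : ∑ s, ((F s - P s - U s) -
      (F s - (Horig s + ∑ c ∈ univ.filter (fun c => parent c = some s), U c))) =
      ∑ s, Horig s - ∑ s, P s - ∑ s, U s +
        ∑ s, ∑ c ∈ univ.filter (fun c => parent c = some s), U c := by
    rw [← sum_sub_distrib, ← sum_sub_distrib, ← sum_add_distrib]
    exact sum_congr rfl fun s _ => by abel
  rw [hsum, sum_children_eq_sum_nonroot parent U, hsplit, hH, hP]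
  abel

/-! ### §3 The corollaries the certificate uses (over `ℝ`, pivot coordinates `Fin N`) -/

variable {N : ℕ}

/-- **Per-front entrywise bounds majorise the global residual.** With the data of
`residual_eq_sum_frontal` over `ℝ` and `|E_s − A_s| ≤ B_s` entrywise for every front,
`|Hpp − GdG| ≤ Σ_s B_s` entrywise. [cite: DuffReid1983, §3] [cite: Rump2026SparseI, Section 1 (1.8)] -/
theorem abs_residual_le_sum_frontal_bound (parent : S → Option S) (Hpp GdG : Matrix (Fin N) (Fin N) ℝ)
    (F P U Horig B : S → Matrix (Fin N) (Fin N) ℝ) (hH : ∑ s, Horig s = Hpp) (hP : ∑ s, P s = GdG)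
    (hroot : ∀ s, parent s = none → U s = 0)
    (hB : ∀ s i j, |((F s - P s - U s) -
      (F s - (Horig s + ∑ c ∈ univ.filter (fun c => parent c = some s), U c))) i j| ≤ B s i j)
    (i j : Fin N) : |(Hpp - GdG) i j| ≤ (∑ s, B s) i j := by
  rw [residual_eq_sum_frontal parent Hpp GdG F P U Horig hH hP hroot, Matrix.sum_apply, Matrix.sum_apply]
  exact (abs_sum_le_sum_abs _ _).trans (sum_le_sum fun s _ => hB s i j)

/-- **The `ρ` of `cap.ila.mfldl` bounds the global residual in norm.** Fronts with parent map `parent`,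
original entries `Horig` summing to the SYMMETRIC `Hpp = H(p,p)`, a factor `G` with column partition `blk`
and signs `d`, float fronts `F`, passed-up blocks `U` (roots pass `0`), per-front entrywise bounds `B_s` of
`E_s − A_s` (local product `P_s = G_s·diag(d)·G_sᵀ`, `G_s = G·diag(χ_s)`), `W := Σ_s B_s`, a positive Collatz vector `x` and
`0 ≤ ρ` with `((W + Wᵀ)x)_i ≤ 2ρ·x_i` for all `i`. Then `‖(Hpp − G·diag(d)·Gᵀ) v‖₂ ≤ ρ‖v‖₂` for every `v` —
hypothesis `hΔ` of `AugmentedInertiaCertificate.sigma_lower_of_augmented_certificate` with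
`Δ := Hpp − G·diag(d)·Gᵀ`. [cite: Rump2026SparseI, Section 1 (1.8)] [cite: DuffReid1983, §3] -/
theorem norm_residual_mulVec_le_of_frontal_bounds (parent : S → Option S)
    (Hpp G : Matrix (Fin N) (Fin N) ℝ) (d : Fin N → ℝ) (blk : Fin N → S)
    (F U Horig B : S → Matrix (Fin N) (Fin N) ℝ) (hHsymm : Hppᵀ = Hpp) (hH : ∑ s, Horig s = Hpp)
    (hroot : ∀ s, parent s = none → U s = 0)
    (hB : ∀ s i j, |((F s - G * diagonal (fun k => if blk k = s then (1 : ℝ) else 0) * diagonal d *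
        (G * diagonal (fun k => if blk k = s then (1 : ℝ) else 0))ᵀ - U s) -
      (F s - (Horig s + ∑ c ∈ univ.filter (fun c => parent c = some s), U c))) i j| ≤ B s i j)
    {x : Fin N → ℝ} (hx : ∀ i, 0 < x i) {ρ : ℝ} (hρ : 0 ≤ ρ)
    (hc : ∀ i, (((∑ s, B s) + (∑ s, B s)ᵀ) *ᵥ x) i ≤ 2 * ρ * x i) (v : Fin N → ℝ) :
    ‖toLp 2 ((Hpp - G * diagonal d * Gᵀ) *ᵥ v)‖ ≤ ρ * ‖toLp 2 v‖ := by
  have hW : ∀ i j, |(Hpp - G * diagonal d * Gᵀ) i j| ≤ (∑ s, B s) i j :=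
    abs_residual_le_sum_frontal_bound parent Hpp (G * diagonal d * Gᵀ) F
      (fun s => G * diagonal (fun k => if blk k = s then (1 : ℝ) else 0) * diagonal d *
        (G * diagonal (fun k => if blk k = s then (1 : ℝ) else 0))ᵀ) U Horig B hH
      (mul_diagonal_mul_transpose_eq_sum_blockCol G d blk).symm hroot hB
  have hΔ : (Hpp - G * diagonal d * Gᵀ)ᵀ = Hpp - G * diagonal d * Gᵀ := by
    rw [transpose_sub, hHsymm, transpose_mul, transpose_mul, transpose_transpose, diagonal_transpose,
      Matrix.mul_assoc]
  exact SparseLUSplit.norm_toLp_mulVec_le_of_symm_collatz hΔ hW hx hρ hc v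

end Literature.Analysis.Matrix.MultifrontalResidual
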